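import Summits.Parity.GeneralizedHardyLittlewood.Theorems.GreenTaoLevelTwoGITwoCyclicInverseBogolyubov
import Mathlib.Combinatorics.Additive.Energy

/-!
# Route `GreenTaoLevelTwo`, crux `GITwo` (stmt-Parity-21275), line `birth`, stub `stub_cyclicInverse`:
# the counting core of the local Bogolyubov lemma (GT08a arXiv Lemma 42, first half)

Thirty-second helper file toward the XL stub `stub_cyclicInverse` (B. Green, T. Tao, *An inverse
theorem for the Gowers `U³(G)` norm*, arXiv:math/0503014, Thm. 68 = PEMS 51 (2008) Thm. 12.8).
Block B8, arXiv Lemma 42 (local Bogolyubov: `A ⊆ B(S,ρ)` of relative density `δ` gives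
`B(S ∪ S', c δ^C ρ/d) ⊆ 2A − 2A` with `#S' ≤ 2⁷δ⁻³`).  Its proof has a COUNTING half (Fourier
inversion for `1_A ∗ 1_{A'} ∗ 1_{−A} ∗ 1_{−A'}`, Cauchy–Schwarz through the additive energy, and the
"real parts" estimate placing every `x` with `Re e(xξ) ≥ ½` on the large spectrum `R` of `A'` inside
`A + A' − A − A'`) and a COVERING half (arXiv Cor. 41, landed as `exists_cover_largeSpec`, bounding
`R` by few Bohr conditions).  This def-free file lands the counting half for two arbitrary finsets
`A, A' ⊆ ℤ/Mℤ`, in the vocabulary of the sibling file `…Bogolyubov` (`dftCoeff`, `ZMod.stdAddChar`):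

* `card_mixed_quadruples_eq_sum_dft` — `#{((a,c),(a',c')) ∈ A²×A'² : (a−c)+(a'−c') = x}
  = M³ Σ_ξ |1̂_A(ξ)|²|1̂_{A'}(ξ)|² e(xξ/M)`;
* `addEnergy_eq_card_mixed_quadruples_zero` — at `x = 0` this is Mathlib's additive energy `E[A,A']`,
  so `M³ Σ_ξ |1̂_A|²|1̂_{A'}|² = E[A,A'] ≥ #A² #A'²/#(A+A')` (`Finset.le_card_add_mul_addEnergy`);
* `card_mixed_quadruples_ge` — **the counting core**: if `Re e(xξ/M) ≥ ½` for every `ξ` with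
  `‖1̂_{A'}(ξ)‖ ≥ t`, then
  `#{… = x} ≥ ½ E[A,A'] − (3/2) t² M² #A`;
* `exists_mixed_repr_of_re_ge_half` — hence `x ∈ A + A' − A − A'` as soon as
  `3 t² M² #A · #(A+A') < #A² #A'²`.

References: [GreenTao2008U3Inverse] arXiv:math/0503014, Lemma 42 (proof, up to display (a0) and the
real-parts estimate).
-/

noncomputable section

open Finset ZMod
open scoped BigOperators ComplexConjugate Combinatorics.Additive Pointwise

namespace Summit.Parity.GeneralizedHardyLittlewood.GreenTaoLevelTwoGITwoCyclicInverse

open Literature.NumberTheory.Sieve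

variable {M : ℕ} [NeZero M]

/-- **Mixed convolution identity** (`1_A ∗ 1_{A'} ∗ 1_{−A} ∗ 1_{−A'}` via Fourier inversion):
`#{((a,c),(a',c')) ∈ A²×A'² : (a − c) + (a' − c') = x} = M³ Σ_ξ |1̂_A(ξ)|² |1̂_{A'}(ξ)|² e(xξ/M)`.
[cite: GreenTao2008U3Inverse, Lemma 42 (proof, display (aaaa))] -/
theorem card_mixed_quadruples_eq_sum_dft (A A' : Finset (ZMod M)) (x : ZMod M) :
    ((#{q ∈ (A ×ˢ A) ×ˢ (A' ×ˢ A') | q.1.1 - q.1.2 + (q.2.1 - q.2.2) = x} : ℕ) : ℂ) =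
      (M : ℂ) ^ 3 * ∑ ξ : ZMod M,
        ((‖dftCoeff (fun y => if y ∈ A then (1 : ℝ) else 0) ξ‖ ^ 2 *
            ‖dftCoeff (fun y => if y ∈ A' then (1 : ℝ) else 0) ξ‖ ^ 2 : ℝ) : ℂ) *
          stdAddChar (x * ξ) := by
  have hM : (M : ℂ) ≠ 0 := by exact_mod_cast NeZero.ne M
  set z : ZMod M → ℂ := fun ξ => dftCoeff (fun y => if y ∈ A then (1 : ℝ) else 0) ξ with hz
  set z' : ZMod M → ℂ := fun ξ => dftCoeff (fun y => if y ∈ A' then (1 : ℝ) else 0) ξ with hz'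
  -- each summand, multiplied by `M⁴`, is a character sum over quadruples
  have key : ∀ ξ : ZMod M, (M : ℂ) ^ 4 *
      (((‖z ξ‖ ^ 2 * ‖z' ξ‖ ^ 2 : ℝ) : ℂ) * stdAddChar (x * ξ)) =
      ∑ q ∈ (A ×ˢ A) ×ˢ (A' ×ˢ A'),
        (stdAddChar (((q.1.2 - q.1.1) + (q.2.2 - q.2.1) + x) * ξ) : ℂ) := by
    intro ξ
    have h2 : (((‖z ξ‖ ^ 2 * ‖z' ξ‖ ^ 2 : ℝ)) : ℂ) = (z ξ * conj (z ξ)) * (z' ξ * conj (z' ξ)) := by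
      rw [Complex.ofReal_mul, ofReal_norm_sq_eq_mul_conj, ofReal_norm_sq_eq_mul_conj]
    rw [h2, show (M : ℂ) ^ 4 * ((z ξ * conj (z ξ)) * (z' ξ * conj (z' ξ)) * stdAddChar (x * ξ)) =
      (((M : ℂ) * M) * (z ξ * conj (z ξ))) * (((M : ℂ) * M) * (z' ξ * conj (z' ξ))) *
        stdAddChar (x * ξ) by ring]
    rw [hz, hz', dftCoeff_indicator_mul_conj_eq, dftCoeff_indicator_mul_conj_eq, Finset.sum_mul_sum]
    simp_rw [Finset.sum_mul]
    rw [← Finset.sum_product']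
    refine Finset.sum_congr rfl fun q _ => ?_
    rw [← AddChar.map_add_eq_mul, ← AddChar.map_add_eq_mul]
    congr 1
    ring
  -- sum over `ξ` and use orthogonality
  have hsum : (M : ℂ) ^ 4 * ∑ ξ : ZMod M, (((‖z ξ‖ ^ 2 * ‖z' ξ‖ ^ 2 : ℝ)) : ℂ) * stdAddChar (x * ξ) =
      (M : ℂ) * #{q ∈ (A ×ˢ A) ×ˢ (A' ×ˢ A') | q.1.1 - q.1.2 + (q.2.1 - q.2.2) = x} := by
    have hfilter :
        ({q ∈ (A ×ˢ A) ×ˢ (A' ×ˢ A') | q.1.2 - q.1.1 + (q.2.2 - q.2.1) + x = 0} : Finset _) =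
        {q ∈ (A ×ˢ A) ×ˢ (A' ×ˢ A') | q.1.1 - q.1.2 + (q.2.1 - q.2.2) = x} :=
      Finset.filter_congr fun q _ =>
        ⟨fun h => by linear_combination -h, fun h => by linear_combination -h⟩
    rw [Finset.mul_sum]
    simp_rw [key]
    rw [Finset.sum_comm]
    simp_rw [sum_stdAddChar_mul_eq]
    rw [← Finset.sum_filter, sum_const, nsmul_eq_mul, hfilter, mul_comm]
  have h4 : (M : ℂ) ^ 4 = M * (M : ℂ) ^ 3 := by ring
  rw [h4, mul_assoc] at hsum
  exact (mul_left_cancel₀ hM hsum).symm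

omit [NeZero M] in
/-- At `x = 0` the mixed quadruple count is Mathlib's additive energy `E[A, A']`. [folklore] -/
theorem addEnergy_eq_card_mixed_quadruples_zero (A A' : Finset (ZMod M)) :
    E[A, A'] = #{q ∈ (A ×ˢ A) ×ˢ (A' ×ˢ A') | q.1.1 - q.1.2 + (q.2.1 - q.2.2) = 0} := by
  rw [Finset.addEnergy]
  congr 1
  refine Finset.filter_congr fun q _ => ⟨fun h => ?_, fun h => ?_⟩
  · linear_combination h
  · linear_combination h

/-- **The counting core of the local Bogolyubov lemma.**  Let `A, A' ⊆ ℤ/Mℤ`, `t ≥ 0`, and let `x`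
satisfy `Re e(xξ/M) ≥ ½` for every `ξ` in the large spectrum `{‖1̂_{A'}(ξ)‖ ≥ t}` of `A'`
(`t` real).  Then
`#{((a,c),(a',c')) ∈ A²×A'² : (a−c)+(a'−c') = x} ≥ ½ E[A,A'] − (3/2) t² M² #A`.
[cite: GreenTao2008U3Inverse, Lemma 42 (proof)] -/
theorem card_mixed_quadruples_ge (A A' : Finset (ZMod M)) (x : ZMod M) {t : ℝ}
    (hx : ∀ ξ : ZMod M, t ≤ ‖dftCoeff (fun y => if y ∈ A' then (1 : ℝ) else 0) ξ‖ →
      1 / 2 ≤ (stdAddChar (x * ξ) : ℂ).re) :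
    1 / 2 * (E[A, A'] : ℝ) - 3 / 2 * t ^ 2 * (M : ℝ) ^ 2 * #A ≤
      #{q ∈ (A ×ˢ A) ×ˢ (A' ×ˢ A') | q.1.1 - q.1.2 + (q.2.1 - q.2.2) = x} := by
  classical
  have hMpos : (0 : ℝ) < M := by exact_mod_cast Nat.pos_of_ne_zero (NeZero.ne M)
  obtain ⟨w, hw⟩ : ∃ w : ZMod M → ℝ,
      ∀ ξ, w ξ = ‖dftCoeff (fun y => if y ∈ A then (1 : ℝ) else 0) ξ‖ ^ 2 := ⟨_, fun _ => rfl⟩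
  obtain ⟨w', hw'⟩ : ∃ w' : ZMod M → ℝ,
      ∀ ξ, w' ξ = ‖dftCoeff (fun y => if y ∈ A' then (1 : ℝ) else 0) ξ‖ ^ 2 := ⟨_, fun _ => rfl⟩
  have hw0 : ∀ ξ, 0 ≤ w ξ := fun ξ => by rw [hw]; positivity
  have hw'0 : ∀ ξ, 0 ≤ w' ξ := fun ξ => by rw [hw']; positivity
  -- the count at `x` and at `0` as real sums
  have hcount : ∀ y : ZMod M,
      (#{q ∈ (A ×ˢ A) ×ˢ (A' ×ˢ A') | q.1.1 - q.1.2 + (q.2.1 - q.2.2) = y} : ℝ) =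
      (M : ℝ) ^ 3 * ∑ ξ : ZMod M, w ξ * w' ξ * (stdAddChar (y * ξ) : ℂ).re := by
    intro y
    have h := congrArg Complex.re (card_mixed_quadruples_eq_sum_dft A A' y)
    rw [Complex.natCast_re] at h
    have h3 : ((M : ℂ) ^ 3) = (((M : ℝ) ^ 3 : ℝ) : ℂ) := by push_cast; ring
    rw [h, h3, Complex.re_ofReal_mul, Complex.re_sum]
    congr 1
    refine Finset.sum_congr rfl fun ξ _ => ?_
    rw [Complex.re_ofReal_mul, hw, hw']
  have hE : (E[A, A'] : ℝ) = (M : ℝ) ^ 3 * ∑ ξ : ZMod M, w ξ * w' ξ := by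
    rw [addEnergy_eq_card_mixed_quadruples_zero, hcount 0]
    congr 1
    refine Finset.sum_congr rfl fun ξ _ => ?_
    rw [zero_mul, AddChar.map_zero_eq_one, Complex.one_re, mul_one]
  -- termwise lower bound: `w w' Re e ≥ ½ w w' − (3/2) w w' 1_{ξ ∉ R} ≥ ½ w w' − (3/2) t² w`
  have hterm : ∀ ξ : ZMod M,
      1 / 2 * (w ξ * w' ξ) - 3 / 2 * (t ^ 2 * w ξ) ≤ w ξ * w' ξ * (stdAddChar (x * ξ) : ℂ).re := by
    intro ξ
    have hre : -1 ≤ (stdAddChar (x * ξ) : ℂ).re := by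
      have h1 := Complex.abs_re_le_norm (stdAddChar (x * ξ) : ℂ)
      rw [norm_stdAddChar] at h1
      exact neg_le_of_abs_le h1
    rcases le_or_gt t (‖dftCoeff (fun y => if y ∈ A' then (1 : ℝ) else 0) ξ‖) with hge | hlt
    · have h2 := hx ξ hge
      have h3 : 0 ≤ w ξ * w' ξ := mul_nonneg (hw0 ξ) (hw'0 ξ)
      have h4 : 0 ≤ t ^ 2 * w ξ := mul_nonneg (sq_nonneg _) (hw0 ξ)
      nlinarith
    · -- off the spectrum `w' ξ < t²`
      have h2 : w' ξ ≤ t ^ 2 := by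
        rw [hw']
        exact pow_le_pow_left₀ (norm_nonneg _) hlt.le 2
      have h3 : 0 ≤ w ξ * w' ξ := mul_nonneg (hw0 ξ) (hw'0 ξ)
      have h5 : w ξ * w' ξ ≤ t ^ 2 * w ξ := by
        rw [mul_comm (t ^ 2)]; exact mul_le_mul_of_nonneg_left h2 (hw0 ξ)
      nlinarith
  -- summing, with Parseval `Σ w = #A/M`
  have hpars : ∑ ξ : ZMod M, w ξ = (#A : ℝ) / M := by
    simp_rw [hw]; exact sum_norm_dftCoeff_indicator_sq A
  have hsumge : 1 / 2 * ∑ ξ : ZMod M, w ξ * w' ξ - 3 / 2 * (t ^ 2 * ((#A : ℝ) / M)) ≤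
      ∑ ξ : ZMod M, w ξ * w' ξ * (stdAddChar (x * ξ) : ℂ).re := by
    have h1 := sum_le_sum fun ξ (_ : ξ ∈ (univ : Finset (ZMod M))) => hterm ξ
    rw [sum_sub_distrib, ← mul_sum, ← mul_sum, ← mul_sum, hpars] at h1
    exact h1
  rw [hcount x, hE]
  have hM3 : (0 : ℝ) ≤ (M : ℝ) ^ 3 := by positivity
  have h2 := mul_le_mul_of_nonneg_left hsumge hM3
  have h3 : (M : ℝ) ^ 3 * (1 / 2 * ∑ ξ : ZMod M, w ξ * w' ξ - 3 / 2 * (t ^ 2 * ((#A : ℝ) / M))) =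
      1 / 2 * ((M : ℝ) ^ 3 * ∑ ξ : ZMod M, w ξ * w' ξ) - 3 / 2 * t ^ 2 * (M : ℝ) ^ 2 * #A := by
    field_simp
  linarith

/-- **Consequence**: if moreover `3 t² M² #A · #(A + A') < #A² #A'²`, then `x ∈ A + A' − A − A'`,
i.e. `x = (a − c) + (a' − c')` with `a, c ∈ A`, `a', c' ∈ A'` (Cauchy–Schwarz
`E[A,A'] · #(A+A') ≥ #A² #A'²`). [cite: GreenTao2008U3Inverse, Lemma 42 (proof)] -/
theorem exists_mixed_repr_of_re_ge_half (A A' : Finset (ZMod M)) (x : ZMod M) {t : ℝ}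
    (hx : ∀ ξ : ZMod M, t ≤ ‖dftCoeff (fun y => if y ∈ A' then (1 : ℝ) else 0) ξ‖ →
      1 / 2 ≤ (stdAddChar (x * ξ) : ℂ).re)
    (hsmall : 3 * t ^ 2 * (M : ℝ) ^ 2 * #A * #(A + A') < (#A : ℝ) ^ 2 * (#A' : ℝ) ^ 2) :
    ∃ a ∈ A, ∃ c ∈ A, ∃ a' ∈ A', ∃ c' ∈ A', a - c + (a' - c') = x := by
  have hcount := card_mixed_quadruples_ge A A' x hx
  have hCS : (#A : ℝ) ^ 2 * (#A' : ℝ) ^ 2 ≤ #(A + A') * (E[A, A'] : ℝ) := by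
    exact_mod_cast Finset.le_card_add_mul_addEnergy A A'
  -- positivity of the count
  have hpos : (0 : ℝ) < #{q ∈ (A ×ˢ A) ×ˢ (A' ×ˢ A') | q.1.1 - q.1.2 + (q.2.1 - q.2.2) = x} := by
    by_contra hle
    push Not at hle
    have h0 : 1 / 2 * (E[A, A'] : ℝ) ≤ 3 / 2 * t ^ 2 * (M : ℝ) ^ 2 * #A := by linarith
    have h1 : (#(A + A') : ℝ) * (E[A, A'] : ℝ) ≤ #(A + A') * (3 * t ^ 2 * (M : ℝ) ^ 2 * #A) :=
      mul_le_mul_of_nonneg_left (by linarith) (by positivity)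
    nlinarith
  have hne : ({q ∈ (A ×ˢ A) ×ˢ (A' ×ˢ A') | q.1.1 - q.1.2 + (q.2.1 - q.2.2) = x} :
      Finset _).Nonempty := by
    rw [← Finset.card_pos]; exact_mod_cast hpos
  obtain ⟨q, hq⟩ := hne
  rw [mem_filter, mem_product, mem_product, mem_product] at hq
  exact ⟨q.1.1, hq.1.1.1, q.1.2, hq.1.1.2, q.2.1, hq.1.2.1, q.2.2, hq.1.2.2, hq.2⟩

end Summit.Parity.GeneralizedHardyLittlewood.GreenTaoLevelTwoGITwoCyclicInverse
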